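import Summits.QuantumFields.YangMills.Theorems.TwistedTraceScaling.Negative.UniformAllSizes
import Summits.QuantumFields.YangMills.Theorems.TwistedTraceScaling.Negative.FalseWithoutBetaGeOne
import Summits.QuantumFields.YangMills.Theorems.TwistedTraceScaling.Negative.TraceRatioMonotone
import HarnessLib

/-!
# Guards on the window-free label limit LIM (the smallest currency of the open stub CMP-2LOOP): both side conditions of LIM are
# load-bearing — crux disprover, cycle 62 (route `LuscherReduction`, crux `TwistedTraceScaling` stmt-QuantumFields-20203; `--supports`, helper only)

`Negative/UniformAllSizes.lean` (R75) certified `TwoLattice.Stmt.stub_cmpTwoLoop ⟺ LIM`, where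

  LIM:  `∀ s ε, ∃ Λ0 > 0, ∀ L ≥ 1, ∀ β, 1 ≤ β → 0 < Λ(β, L) → Λ(β, L) ≤ Λ0 → |r_L(β, ⌈sL/Λ(β,L)⌉) − r_𝔥(s)| ≤ ε`,

and proposed LIM as the replacement text of the stub for a skeleton rev 4.  A planner reading "`Λ(β, L) → 0`" as "weak coupling" might
drop one of the two guards `1 ≤ β`, `0 < Λ(β, L)`.  This file shows that EACH is load-bearing on its own (statements spelled out
inline; no proposition is defined under `Summits/`):

* `labelLimit_false_without_betaGeOne` — WITHOUT `1 ≤ β` (keeping `0 < Λ ≤ Λ0`) LIM is false: on the one-link lattice `L = 1` the label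
  equation `Λ(β, 1) = lam` has a STRONG-coupling root `0 < β ≤ 2b₀e^{b₀/(2b₁)}e^{−(b₀/b₁)/lam³}` (✓`StrongCouplingBranch.exists_strong_window`);
  there `T = ⌈1/lam⌉ ≤ 2/lam` and the kernel sandwich ✓`one_sub_le_traceRatio` gives `r_1(β, T) ≥ 1 − 4c₁βT ≥ 1 − ε` (`βT ≲ lam²`), while
  `r_𝔥(1) = 1 − 4ε < 1` (✓`hTraceRatio_lt_one`).  (For the crux itself this is ✓`twistedTraceScaling_false_without_betaGeOne(_keeping_threshold)`;
  here no one-site comparison and no `L`-uniformity are needed, because LIM is stated against `r_𝔥` and at every `L`.)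
* `labelLimit_false_without_lambdaPos` — WITHOUT `0 < Λ(β, L)` (keeping `1 ≤ β`, `Λ ≤ Λ0`) LIM is false FOR A REASON OF JUNK: at `β = 1` and
  any `L ≥ e^{1/(4b₀)}` (`= e^{6π²/11} ≈ 218`) the two-loop size label is past its Landau root, `1/ḡ²(β, L) ≤ 0`
  (`invRunningCoupling_nonpos_of_log_ge`), so `Λ(β, L) = 0^{−1/3} = 0` (`luscherLambda_eq_zero_of_invRunningCoupling_nonpos`) and
  `⌈sL/Λ⌉ = ⌈sL/0⌉ = 0` for EVERY `s` (`femtoSteps_eq_zero_of_luscherLambda_eq_zero`): the left side `r_L(1, 0)` does not depend on `s`,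
  whereas `r_𝔥(1) > 0` (✓`hTraceRatio_pos`) and `r_𝔥(s) < r_𝔥(1)/3` for small `s` (✓`hTraceRatio_lt_of_small`) — two instances of LIM⁻ at
  tolerance `r_𝔥(1)/4` contradict each other.  No value of any lattice trace is needed.

Moral for the planner of rev 4: keep BOTH guards verbatim (`1 ≤ β` selects the weak root of the label equation; `0 < Λ(β, L)` excludes the
junk branch `Λ = 0` of `luscherLambda` beyond the Landau root, which `β ≥ 1` alone does not exclude once `log L ≥ β/(4b₀)`).
HONEST FRAMING: guards on a hypothesis text equivalent to an OPEN stub of a child of the CONDITIONAL reduction route R2b1; the crux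
`TwistedTraceScaling` is NOT refuted and NOT closed; fixed-lattice statements only — not infinite volume, not a mass gap, not Clay.
No definitions, no `sorry`.
-/

set_option autoImplicit false

noncomputable section

open MeasureTheory Filter Topology Real
open Literature.MathematicalPhysics.QuantumFieldTheory hiding SU2
open Literature.MathematicalPhysics.QuantumLattice
open Literature.Analysis.OperatorTheory.YMMatrixModel
open scoped BigOperators

namespace Summit.QuantumFields.YangMills.Theorems.TwistedTraceScaling.Negative

open Summit.QuantumFields.YangMills.Theorems.FemtoTransferGap
open Summit.QuantumFields.YangMills.Theorems.FemtoTransferGap.TraceDoor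
open Summit.QuantumFields.YangMills.Theorems.FemtoTransferGap.TT
open Summit.QuantumFields.YangMills.Theorems.FemtoTransferGap.TwoLattice

namespace R75b

/-! ## §1 The junk branch of the two-loop label: `Λ(β, L) = 0` past the Landau root, even at `β ≥ 1` -/

/-- Past the Landau root of the two-loop size label the inverse running coupling is non-positive: for `β ≥ 2b₀` (so `log(2b₀/β) ≤ 0`) and
`log L ≥ β/(4b₀)`, `1/ḡ²(β, L) = β/2 − 2b₀ log L + (b₁/b₀) log(2b₀/β) ≤ 0`. [cite: LuscherMunster1984, §2] -/
theorem invRunningCoupling_nonpos_of_log_ge {β : ℝ} (hβ : 2 * b0 ≤ β) {L : ℕ} (hL : β / (4 * b0) ≤ Real.log (L : ℝ)) :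
    invRunningCoupling β L ≤ 0 := by
  have hb0 : 0 < b0 := by unfold b0; positivity
  have hb1 : 0 < b1 := by unfold b1; positivity
  have hβ0 : 0 < β := lt_of_lt_of_le (by positivity) hβ
  have hlog : Real.log (2 * b0 / β) ≤ 0 :=
    Real.log_nonpos (by positivity) (by rw [div_le_one hβ0]; exact hβ)
  have hsize : 0 ≤ sizeLog β L := by
    unfold sizeLog
    have h1 : (b1 / (2 * b0 ^ 2)) * Real.log (2 * b0 / β) ≤ 0 :=
      mul_nonpos_of_nonneg_of_nonpos (by positivity) hlog
    linarith
  have h2 : invRunningCoupling β L = -(2 * b0 * sizeLog β L) := by unfold invRunningCoupling; ring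
  rw [h2, neg_nonpos]
  positivity

/-- On that branch Lüscher's label takes its JUNK value: `Λ(β, L) = (max (1/ḡ²) 0)^{−1/3} = 0^{−1/3} = 0`. [folklore] -/
theorem luscherLambda_eq_zero_of_invRunningCoupling_nonpos {β : ℝ} {L : ℕ} (h : invRunningCoupling β L ≤ 0) :
    luscherLambda β L = 0 := by
  unfold luscherLambda
  rw [max_eq_right h, Real.zero_rpow (by norm_num)]

/-- … and then the calibrated number of transfer steps is `⌈sL/0⌉ = 0` for EVERY `s`. [folklore] -/
theorem femtoSteps_eq_zero_of_luscherLambda_eq_zero {β : ℝ} {L : ℕ} (h : luscherLambda β L = 0) (s : ℝ) :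
    femtoSteps s β L = 0 := by
  unfold femtoSteps
  rw [h, div_zero]
  exact Nat.ceil_zero

/-- A concrete junk lattice at `β = 1`: `L = ⌈e^{1/(4b₀)}⌉` (`≈ 218`) has `Λ(1, L) = 0`. [folklore] -/
theorem luscherLambda_one_ceil_exp_eq_zero : luscherLambda 1 ⌈Real.exp (1 / (4 * b0))⌉₊ = 0 := by
  apply luscherLambda_eq_zero_of_invRunningCoupling_nonpos
  apply invRunningCoupling_nonpos_of_log_ge (by simpa using BOHandover.two_mul_b0_le_one)
  have h1 : Real.exp (1 / (4 * b0)) ≤ ((⌈Real.exp (1 / (4 * b0))⌉₊ : ℕ) : ℝ) := Nat.le_ceil _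
  calc (1 : ℝ) / (4 * b0) = Real.log (Real.exp (1 / (4 * b0))) := (Real.log_exp _).symm
    _ ≤ _ := Real.log_le_log (Real.exp_pos _) h1

/-! ## §2 LIM is false without `0 < Λ(β, L)` (junk branch) -/

/-- **LIM without the guard `0 < Λ(β, L)` is false** (statement spelled out inline: R75's LIM with `0 < luscherLambda β L` deleted).  Witness: the
junk lattice `β = 1`, `L = ⌈e^{1/(4b₀)}⌉` (`Λ = 0 ≤ Λ0`, `T = 0` for every `s`, so the lattice side `r_L(1, 0)` is `s`-independent) against
`r_𝔥(1) > 0` and `r_𝔥(s₂) < r_𝔥(1)/3` (`s₂` small, ✓`hTraceRatio_lt_of_small`), both at tolerance `r_𝔥(1)/4`. [folklore] -/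
theorem labelLimit_false_without_lambdaPos :
    ¬ (∀ s : ℝ, 0 < s → ∀ ε : ℝ, 0 < ε → ∃ Λ0 : ℝ, 0 < Λ0 ∧
        ∀ (L : ℕ) [NeZero L], ∀ β : ℝ, 1 ≤ β → luscherLambda β L ≤ Λ0 →
          |traceRatio L β (femtoSteps s β L) - hTraceRatio s| ≤ ε) := by
  intro h
  -- the junk lattice
  obtain ⟨L, hL⟩ : ∃ L : ℕ, L = ⌈Real.exp (1 / (4 * b0))⌉₊ := ⟨_, rfl⟩
  have hLpos : 0 < L := by rw [hL]; exact Nat.ceil_pos.mpr (Real.exp_pos _)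
  haveI : NeZero L := ⟨hLpos.ne'⟩
  have hΛ : luscherLambda 1 L = 0 := by rw [hL]; exact luscherLambda_one_ceil_exp_eq_zero
  -- `r_𝔥(1) > 0`, `r_𝔥(s₂) < r_𝔥(1)/3`
  have hr1 : 0 < hTraceRatio 1 := hTraceRatio_pos one_pos
  obtain ⟨s₀, hs₀, hsmall⟩ := hTraceRatio_lt_of_small (c := hTraceRatio 1 / 3) (by positivity)
  obtain ⟨s₂, hs₂def⟩ : ∃ s₂ : ℝ, s₂ = min s₀ 1 := ⟨_, rfl⟩
  have hs₂ : 0 < s₂ := by rw [hs₂def]; exact lt_min hs₀ one_pos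
  have hr2 : hTraceRatio s₂ < hTraceRatio 1 / 3 := hsmall s₂ hs₂ (by rw [hs₂def]; exact min_le_left _ _)
  -- two instances of the hypothesis at the junk lattice
  obtain ⟨Λ1, hΛ1, H1⟩ := h 1 one_pos (hTraceRatio 1 / 4) (by positivity)
  obtain ⟨Λ2, hΛ2, H2⟩ := h s₂ hs₂ (hTraceRatio 1 / 4) (by positivity)
  have h1 := H1 L 1 le_rfl (by rw [hΛ]; exact hΛ1.le)
  have h2 := H2 L 1 le_rfl (by rw [hΛ]; exact hΛ2.le)
  rw [femtoSteps_eq_zero_of_luscherLambda_eq_zero hΛ] at h1 h2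
  have e1 := (abs_le.mp h1).1
  have e2 := (abs_le.mp h2).2
  linarith

/-! ## §3 LIM is false without `1 ≤ β` (strong-coupling root) -/

/-- **LIM without the guard `1 ≤ β` is false** (statement spelled out inline: R75's LIM with `1 ≤ β` deleted).  Witness: `s = 1`, `ε = (1 − r_𝔥(1))/4`,
the one-link lattice `L = 1`, a depth `lam ≤ min(Λ0, 1/2, ε/C)` (`C = 16b₀e^{κ/2}(c₁+1)/κ`, `κ = b₀/b₁`, `c₁ = 2|E|+4|P|` at `L = 1`) and the
STRONG-coupling root `0 < β ≤ 2b₀e^{κ/2}e^{−κ/lam³}` of `Λ(β, 1) = lam` (✓`exists_strong_window`): `0 < Λ = lam ≤ Λ0`, `T = ⌈1/lam⌉ ≤ 2/lam`,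
`r_1(β, T) ≥ 1 − 4c₁βT ≥ 1 − C·lam ≥ 1 − ε` (✓`one_sub_le_traceRatio`, `e^{−κ/lam³} ≤ lam³/κ`), against `r_𝔥(1) = 1 − 4ε`. [folklore] -/
theorem labelLimit_false_without_betaGeOne :
    ¬ (∀ s : ℝ, 0 < s → ∀ ε : ℝ, 0 < ε → ∃ Λ0 : ℝ, 0 < Λ0 ∧
        ∀ (L : ℕ) [NeZero L], ∀ β : ℝ, 0 < luscherLambda β L → luscherLambda β L ≤ Λ0 →
          |traceRatio L β (femtoSteps s β L) - hTraceRatio s| ≤ ε) := by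
  intro h
  have hr1 : hTraceRatio 1 < 1 := hTraceRatio_lt_one one_pos
  obtain ⟨g, hg⟩ : ∃ g : ℝ, g = 1 - hTraceRatio 1 := ⟨_, rfl⟩
  have hg0 : 0 < g := by rw [hg]; linarith
  obtain ⟨Λ0, hΛ0, H⟩ := h 1 one_pos (g / 4) (by positivity)
  have hb0 : 0 < b0 := by unfold b0; positivity
  have hb1 : 0 < b1 := by unfold b1; positivity
  obtain ⟨c1, hc1⟩ : ∃ c1 : ℝ, c1 = 2 * (Fintype.card (Edge 3 1) : ℝ) + 4 * (Fintype.card (Plaquette 3 1) : ℝ) := ⟨_, rfl⟩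
  have hc1nn : 0 ≤ c1 := by rw [hc1]; positivity
  obtain ⟨κ, hκ⟩ : ∃ κ : ℝ, κ = b0 / b1 := ⟨_, rfl⟩
  have hκ0 : 0 < κ := by rw [hκ]; exact div_pos hb0 hb1
  obtain ⟨C, hC⟩ : ∃ C : ℝ, C = 16 * b0 * Real.exp (κ / 2) * (c1 + 1) / κ := ⟨_, rfl⟩
  have hC0 : 0 < C := by rw [hC]; positivity
  -- the depth `lam`
  obtain ⟨lam, hlam_pos, hlam_le0, hlam_half, hlam_g⟩ :
      ∃ lam : ℝ, 0 < lam ∧ lam ≤ Λ0 ∧ lam ≤ 1 / 2 ∧ lam ≤ g / (4 * C) :=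
    ⟨min Λ0 (min (1 / 2) (g / (4 * C))), lt_min hΛ0 (lt_min (by norm_num) (by positivity)), min_le_left _ _,
      (min_le_right _ _).trans (min_le_left _ _), (min_le_right _ _).trans (min_le_right _ _)⟩
  have hlam_one : lam ≤ 1 := by linarith
  -- the strong-coupling root at `L = 1` with `Λ(β, 1) = lam`
  obtain ⟨β, hβ0, -, hβle, hΛ⟩ := exists_strong_window 1 hlam_pos hlam_one
  have hH := H 1 β (by rw [hΛ]; exact hlam_pos) (by rw [hΛ]; exact hlam_le0)
  have hfs : femtoSteps 1 β 1 = ⌈(1 : ℝ) / lam⌉₊ := by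
    unfold femtoSteps; rw [hΛ]; simp only [Nat.cast_one, mul_one]
  obtain ⟨T, hT⟩ : ∃ T : ℕ, T = ⌈(1 : ℝ) / lam⌉₊ := ⟨_, rfl⟩
  rw [hfs, ← hT] at hH
  -- facts about `T = ⌈1/lam⌉`
  have hinv : 2 ≤ 1 / lam := by rw [le_div_iff₀ hlam_pos]; linarith
  have hceil : (1 : ℝ) / lam ≤ T := by rw [hT]; exact Nat.le_ceil _
  have hceil' : (T : ℝ) < 1 / lam + 1 := by rw [hT]; exact Nat.ceil_lt_add_one (by positivity)
  have hT1 : 1 ≤ T := by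
    have : (1 : ℝ) ≤ (T : ℝ) := by linarith
    exact_mod_cast this
  have hTle : (T : ℝ) ≤ 2 / lam := by
    have : (2 : ℝ) / lam = 1 / lam + 1 / lam := by ring
    linarith
  -- the lattice side at the strong-coupling root: `r ≥ 1 − 4 c₁ β T ≥ 1 − g/4`
  have hlow := one_sub_le_traceRatio 1 hβ0.le hT1
  rw [← hc1] at hlow
  have hsmall : 4 * (c1 * β) * T ≤ g / 4 := by
    have he : Real.exp (-(b0 / b1) * (1 / lam ^ 3 - 1 / 2)) = Real.exp (κ / 2) * Real.exp (-(κ / lam ^ 3)) := by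
      rw [← Real.exp_add, hκ]; congr 1; ring
    have hx : 0 < κ / lam ^ 3 := by positivity
    have hex : Real.exp (-(κ / lam ^ 3)) ≤ lam ^ 3 / κ := by
      have h1 : κ / lam ^ 3 + 1 ≤ Real.exp (κ / lam ^ 3) := Real.add_one_le_exp _
      rw [Real.exp_neg]
      calc (Real.exp (κ / lam ^ 3))⁻¹ ≤ (κ / lam ^ 3)⁻¹ := inv_anti₀ hx (by linarith)
        _ = lam ^ 3 / κ := by rw [inv_div]
    have hβ' : β ≤ 2 * b0 * Real.exp (κ / 2) * (lam ^ 3 / κ) := by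
      calc β ≤ 2 * b0 * Real.exp (-(b0 / b1) * (1 / lam ^ 3 - 1 / 2)) := hβle
        _ = 2 * b0 * Real.exp (κ / 2) * Real.exp (-(κ / lam ^ 3)) := by rw [he]; ring
        _ ≤ 2 * b0 * Real.exp (κ / 2) * (lam ^ 3 / κ) := mul_le_mul_of_nonneg_left hex (by positivity)
    calc 4 * (c1 * β) * T ≤ 4 * (c1 * (2 * b0 * Real.exp (κ / 2) * (lam ^ 3 / κ))) * (2 / lam) := by
          apply mul_le_mul _ hTle (by positivity) (by positivity)
          exact mul_le_mul_of_nonneg_left (mul_le_mul_of_nonneg_left hβ' hc1nn) (by norm_num)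
      _ = (16 * b0 * Real.exp (κ / 2) * c1 / κ) * lam ^ 2 := by field_simp; ring
      _ ≤ C * lam ^ 2 := by
          apply mul_le_mul_of_nonneg_right _ (by positivity)
          rw [hC]
          apply div_le_div_of_nonneg_right _ hκ0.le
          exact mul_le_mul_of_nonneg_left (by linarith) (by positivity)
      _ ≤ C * lam := by
          apply mul_le_mul_of_nonneg_left _ hC0.le
          have h1 : lam ^ 2 = lam * lam := by ring
          rw [h1]
          exact mul_le_of_le_one_right hlam_pos.le hlam_one
      _ ≤ C * (g / (4 * C)) := mul_le_mul_of_nonneg_left hlam_g hC0.le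
      _ = g / 4 := by field_simp
  -- contradiction: `r ≥ 1 − g/4` but `r ≤ r_𝔥(1) + g/4 = 1 − 3g/4`
  have h2 : traceRatio 1 β T - hTraceRatio 1 ≤ g / 4 := (abs_le.mp hH).2
  linarith only [hlow, hsmall, h2, hg, hg0]

/-! ## §4 Record: LIM with both guards is exactly the registered stub (R75), so the guards cost nothing and cannot be dropped -/

/-- Bookkeeping corollary for the planner: the guarded text LIM is ⟺ `Stmt.stub_cmpTwoLoop` (R75), and each of its two un-guarded variants is
refuted above — so a rev-4 stub text must carry `1 ≤ β` AND `0 < luscherLambda β L` verbatim. [folklore] -/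
theorem labelLimit_guards_load_bearing :
    (Stmt.stub_cmpTwoLoop ↔
      (∀ s : ℝ, 0 < s → ∀ ε : ℝ, 0 < ε → ∃ Λ0 : ℝ, 0 < Λ0 ∧
        ∀ (L : ℕ) [NeZero L], ∀ β : ℝ, 1 ≤ β → 0 < luscherLambda β L → luscherLambda β L ≤ Λ0 →
          |traceRatio L β (femtoSteps s β L) - hTraceRatio s| ≤ ε)) ∧
    ¬ (∀ s : ℝ, 0 < s → ∀ ε : ℝ, 0 < ε → ∃ Λ0 : ℝ, 0 < Λ0 ∧
        ∀ (L : ℕ) [NeZero L], ∀ β : ℝ, 0 < luscherLambda β L → luscherLambda β L ≤ Λ0 →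
          |traceRatio L β (femtoSteps s β L) - hTraceRatio s| ≤ ε) ∧
    ¬ (∀ s : ℝ, 0 < s → ∀ ε : ℝ, 0 < ε → ∃ Λ0 : ℝ, 0 < Λ0 ∧
        ∀ (L : ℕ) [NeZero L], ∀ β : ℝ, 1 ≤ β → luscherLambda β L ≤ Λ0 →
          |traceRatio L β (femtoSteps s β L) - hTraceRatio s| ≤ ε) :=
  ⟨R75.cmpTwoLoop_iff_labelLimit, labelLimit_false_without_betaGeOne, labelLimit_false_without_lambdaPos⟩

end R75b

end Summit.QuantumFields.YangMills.Theorems.TwistedTraceScaling.Negative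

end
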